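import Literature.Algebra.Polynomial.CasasAlvero.Degree4CharP
import HarnessLib

/-!
# Casas-Alvero in degree ≤ 4: summary statements

`CA_d(K)` for every `d ≤ 4` over a field in which `2, 3, 5, 7 ≠ 0` — in particular over every field of characteristic `0`
(the conjecture's home) and of characteristic `p ≥ 11` — assembled from `holdsInDegree_one/two/three` and `holdsInDegree_four_of_ne`
(plus the trivial degree `0`).  The hypotheses are sharp by `holdsInDegree_three_iff` / `holdsInDegree_four_iff`.
[cite: GrafVonBothmerEtAl2007, Prop. 3]
-/

noncomputable section

open Polynomial

namespace Literature.Algebra.Polynomial.CasasAlvero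

/-- degree `0`: a monic constant is `1 = (X - 0)^0`. [folklore] -/
theorem holdsInDegree_zero (R : Type*) [CommRing R] : HoldsInDegree R 0 := by
  intro f hf hd _
  exact ⟨0, by rw [pow_zero]; exact (Monic.natDegree_eq_zero hf).mp hd⟩

variable (K : Type*) [Field K]

/-- `CA_d(K)` for all `d ≤ 4` when `2, 3, 5, 7 ≠ 0` in `K`. [cite: GrafVonBothmerEtAl2007, Prop. 3] -/
theorem holdsInDegree_of_le_four (h2 : (2 : K) ≠ 0) (h3 : (3 : K) ≠ 0) (h5 : (5 : K) ≠ 0) (h7 : (7 : K) ≠ 0)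
    {d : ℕ} (hd : d ≤ 4) : HoldsInDegree K d := by
  interval_cases d
  · exact holdsInDegree_zero K
  · exact holdsInDegree_one (R := K)
  · exact holdsInDegree_two (R := K)
  · exact holdsInDegree_three (K := K) (by rw [show (6 : K) = 2 * 3 by norm_num]; exact mul_ne_zero h2 h3)
  · exact holdsInDegree_four_of_ne (K := K) h3 h5 h7

/-- The Casas-Alvero conjecture holds in every degree `d ≤ 4` over every field of characteristic `0`. [cite: GrafVonBothmerEtAl2007, Prop. 3] -/
theorem holdsInDegree_of_le_four_of_charZero [CharZero K] {d : ℕ} (hd : d ≤ 4) : HoldsInDegree K d :=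
  holdsInDegree_of_le_four K (by norm_num) (by norm_num) (by norm_num) (by norm_num) hd

/-- … and over every field of characteristic `p ≥ 11`. [cite: GrafVonBothmerEtAl2007, Prop. 3] -/
theorem holdsInDegree_of_le_four_of_charP (p : ℕ) [Fact p.Prime] [CharP K p] (hp : 11 ≤ p) {d : ℕ} (hd : d ≤ 4) :
    HoldsInDegree K d := by
  have hne : ∀ q : ℕ, 0 < q → q < p → ((q : ℕ) : K) ≠ 0 := by
    intro q hq0 hqp h
    rw [CharP.cast_eq_zero_iff K p] at h
    exact absurd (Nat.le_of_dvd hq0 h) (not_le.mpr hqp)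
  refine holdsInDegree_of_le_four K ?_ ?_ ?_ ?_ hd
  · exact_mod_cast hne 2 (by norm_num) (by omega)
  · exact_mod_cast hne 3 (by norm_num) (by omega)
  · exact_mod_cast hne 5 (by norm_num) (by omega)
  · exact_mod_cast hne 7 (by norm_num) (by omega)

end Literature.Algebra.Polynomial.CasasAlvero
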